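import Literature.MathematicalPhysics.QuantumFieldTheory.Balaban1983to89.T4CauchySum

/-!
# T⁴ programme, spine node NE1′ (O3b/H2), COUPLING LINE — the SHRINKING-PHASE arithmetic of the localization format (ζ)
# (skeleton `t4/skeletons/NE1p-t4-ne1p-p3.md` v0.11.2–v0.12.1 §3c row (P-g))

Cell `pub-balaban`, unit `b2b-balaban-t4-ne1p-p3` (ROUND-2 technique-distinct prover #3 on BINDER row NE1′), generation 31.  OUR
elementary lemmas (new work ⇒ `Summits/`), Mathlib only, everything PROVED, no `def`; nothing of T. Bałaban's series is asserted.
Companions: `Support/NE1pPathwiseBlock` (p209631), `Support/NE1pLocalPhase` (p210978), road P4's `Support/CovariantMeanRecursion`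
(p209931; the same device appears there as the «delayed birth m(Λ)» of PROPAGATION-v2 §3.1, paid by the component's size tail).

THE POINT (skeleton (P-g), own-open item (ζ) LOCALIZATION FORMAT).  A covariant flat-vanishing analytic functional of LARGE support
is not small at small curvature (a loop of size `R` feels flux `F·R²`); the Schwarz disc of the pathwise route / of road P4's depth
lemma reaches the actual configuration only for supports `R ≤ R_fit ≍ L^{2s}·O(1)`.  In Bałaban's localized-family format a piece of
size `d` (localization weight `e^{−κd}`) larger than `R_fit` is carried by the trivial insertion bound (factor `C_ins ≥ 1` per block,
no gain) while its support SHRINKS by `L^{−s}` per block, for `b ≤ log d/(s log L) + 1` blocks, and contracts (factor `θ < 1`)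
afterwards; relative to the all-contracting history its cost is `(C_ins/θ)^b`.  This file proves that this cost is POLYNOMIAL in `d`
— `X^b ≤ X·d^{log X/(s log L)}` for `X = C_ins/θ ≥ 1` — and that the resulting family sum `Σ_d e^{−κd}·d^p` converges: the
localization weight pays the shrinking phase, for EVERY polynomial degree `p`.  (The alternative payer — the component's size tail,
road P4's `|Λ|`-moment — is not used here; one payer suffices, synthesis Q-p34-loc-1 (i).)  HONEST: pure real arithmetic; the
localization format itself (pieces, weights `e^{−κd_j(Y)}` — [Balaban1989LargeFieldII] (1.79)–(1.88)-type, [Balaban1988Convergent]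
(2.27)(iii)/(iv)) is a printed-TYPE hypothesis of the skeleton, asserted of no datum.

HONEST FRAMING (T4-DAG p. 1).  Rung (B)+1 on ONE finite four-torus of fixed physical size; NOT infinite volume, NOT a mass gap,
NOT the Clay problem, NOT summit progress.  NE1′ is NOT printed and NOT proved (spine 0/9).  HONEST DEPENDENCY (verbatim):
continuum YM on T⁴ ⇐ BetaPertH ∧ nine spine estimates (0/9 proved); BetaPertH ⇐ (D1) ∧ (D4) ∧ CAP+tail; G-an2-4 gates asym, D1
and NE2/3/4.  CITATION HEADER: no page of the series is quoted here.

WHAT IS PROVED ([folklore], Mathlib only): `pow_le_mul_rpow_of_le_log` (the shrinking-phase cost is polynomial), `summable_exp_neg_mul_rpow` (`Σ_i e^{−κ(i+1)}(i+1)^p < ∞` for `κ > 0`,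
`p ≥ 0` — Mathlib `Real.summable_pow_mul_exp_neg_nat_mul` + comparison via this lineage's `T4CauchySum.rpow_le_pow_natCeil` BY NAME), `shrink_cost_summable` (the assembled family bound).  Imports `…Balaban1983to89.T4CauchySum` (this lineage, gen 7) only.
-/

noncomputable section

open Real Finset
open scoped BigOperators

namespace Summit.QuantumFields.BalabanUV.T4Continuum.NE1pShrinkPhase

/-- **THE SHRINKING-PHASE COST IS POLYNOMIAL.**  If a piece of size `d > 0` needs `b ≤ log d / c + 1` non-contracting blocks
(`c = s·log L > 0` in the skeleton) and each costs a factor `X ≥ 1` (`X = C_ins/θ`), then `X^b ≤ X·d^{log X / c}`. [folklore] -/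
theorem pow_le_mul_rpow_of_le_log {X d c : ℝ} {b : ℕ} (hX : 1 ≤ X) (hd : 0 < d)
    (hb : (b : ℝ) ≤ Real.log d / c + 1) :
    X ^ b ≤ X * d ^ (Real.log X / c) := by
  have hX0 : 0 < X := lt_of_lt_of_le zero_lt_one hX
  have h1 : X ^ b = X ^ (b : ℝ) := (Real.rpow_natCast X b).symm
  rw [h1]
  calc X ^ (b : ℝ) ≤ X ^ (Real.log d / c + 1) := Real.rpow_le_rpow_of_exponent_le hX hb
    _ = X ^ (Real.log d / c) * X := by rw [Real.rpow_add_one hX0.ne']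
    _ = X * X ^ (Real.log d / c) := by ring
    _ = X * d ^ (Real.log X / c) := by
        congr 1
        rw [Real.rpow_def_of_pos hX0, Real.rpow_def_of_pos hd]
        congr 1
        ring

/-- **THE LOCALIZATION WEIGHT PAYS**: `Σ_i e^{−κ(i+1)}·(i+1)^p < ∞` for every `κ > 0`, `p ≥ 0` (sizes `d = i+1 ≥ 1`). [folklore] -/
theorem summable_exp_neg_mul_rpow {κ p : ℝ} (hκ : 0 < κ) (hp : 0 ≤ p) :
    Summable (fun i : ℕ => Real.exp (-κ * (i + 1 : ℝ)) * ((i : ℝ) + 1) ^ p) := by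
  have _ := hp
  have hs : Summable (fun n : ℕ => (n : ℝ) ^ ⌈p⌉₊ * Real.exp (-κ * n)) :=
    Real.summable_pow_mul_exp_neg_nat_mul ⌈p⌉₊ hκ
  have hs1 : Summable (fun i : ℕ => ((i + 1 : ℕ) : ℝ) ^ ⌈p⌉₊ * Real.exp (-κ * ((i + 1 : ℕ) : ℝ))) :=
    (summable_nat_add_iff 1).mpr hs
  refine Summable.of_nonneg_of_le (fun i => by positivity) (fun i => ?_) hs1
  have hi : (1 : ℝ) ≤ (i : ℝ) + 1 := by
    have : (0 : ℝ) ≤ i := Nat.cast_nonneg i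
    linarith
  push_cast
  rw [mul_comm]
  exact mul_le_mul_of_nonneg_right (Literature.MathematicalPhysics.QuantumFieldTheory.Balaban1983to89.T4CauchySum.rpow_le_pow_natCeil hi) (Real.exp_pos _).le

/-- **THE ASSEMBLED FAMILY BOUND.**  If the piece of size `i+1` contributes at most `N·θ^J·X·(i+1)^p·e^{−κ(i+1)}` (all-contracting
factor `θ^J`, shrinking cost `X·(i+1)^p` by `pow_le_mul_rpow_of_le_log`, localization weight `e^{−κ(i+1)}`), then the family's total
is at most `N·θ^J·X·Σ_i e^{−κ(i+1)}(i+1)^p`, a finite number independent of `J`. [folklore] -/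
theorem shrink_cost_summable {κ p N θ X : ℝ} (hκ : 0 < κ) (hp : 0 ≤ p) (J : ℕ) {a : ℕ → ℝ}
    (ha : ∀ i, a i ≤ N * θ ^ J * X * (((i : ℝ) + 1) ^ p * Real.exp (-κ * (i + 1 : ℝ))))
    (hsum : Summable a) :
    ∑' i, a i ≤ N * θ ^ J * X * ∑' i : ℕ, Real.exp (-κ * (i + 1 : ℝ)) * ((i : ℝ) + 1) ^ p := by
  have hS := summable_exp_neg_mul_rpow hκ hp
  rw [← tsum_mul_left]
  refine Summable.tsum_le_tsum (fun i => ?_) hsum (hS.mul_left _)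
  calc a i ≤ N * θ ^ J * X * (((i : ℝ) + 1) ^ p * Real.exp (-κ * (i + 1 : ℝ))) := ha i
    _ = N * θ ^ J * X * (Real.exp (-κ * (i + 1 : ℝ)) * ((i : ℝ) + 1) ^ p) := by ring

end Summit.QuantumFields.BalabanUV.T4Continuum.NE1pShrinkPhase
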